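import Summits.QuantumAdvantage.AdviceFreeQNC0.BlindWindowStrategies
import HarnessLib

/-!
# Cell qa-qnc0 (rung F-Q1, route RingFrame, crux α `RingToElim`): the blind-window theorem,
# polylog form

`ringWinU_blindWindow_le`: there is `θ < 1` such that for every `C` and all large `n`, every walk
strategy on `n` bits with selectors of `𝔽₂`-degree `≤ (log₂ n)^C` whose selectors at the positions
strictly inside some window `(p, p + ℓ)` of `ℓ ≥ 2(log₂ n)^{2C+1}` input bits do not read that
window's bits — they may select those positions at will, as functions of the OTHER bits — wins the
ring game in walk coordinates, for every charge, on at most `θ·2ⁿ` inputs.  One `θ` serves every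
`C`.  (From `ringWinU_blindWindow_sqrt_le` by splitting the window into two halves of
`≥ (log₂ n)^{2C+1}` bits each; `(log₂ n)^C ≤ c₁·√((log₂ n)^{2C+1})` once `c₁²·log₂ n ≥ 1`.)

This contains the low-degree gap theorem `ringWinU_lowDegGap_le` (selectors `≡ 0` inside are
blind; window twice as long) and is the first kernel theorem on crux α with DENSE interior bets.
The cell's theorem (prover qn-prover-3, 2026-08-27); not in print.  WHAT THIS IS NOT: interior
selectors that read their own window (general α) are untouched; no separation.

## References

* S. Srinivasan, *A robust version of Hegedűs's lemma, with applications*, TheoretiCS 2 (2023),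
  Lemma 3.1 [Srinivasan2023] (through `ringWinU_blindWindow_sqrt_le`).
-/

noncomputable section

namespace Summit.QuantumAdvantage.AdviceFreeQNC0

open Finset
open Literature.Computability.MetaComplexity Literature.Computability.MetaComplexity.Smolensky

variable {p ℓ q : ℕ}

/-- Two glued inputs with the same outside blocks agree outside the window. -/
theorem glue3_eq_outside (a : Fin p → Bool) (v v' : Fin ℓ → Bool) (b : Fin q → Bool)
    (i : Fin (p + ℓ + q)) (hi : i.val < p ∨ p + ℓ ≤ i.val) : glue3 a v b i = glue3 a v' b i := by
  unfold glue3
  induction i using Fin.addCases with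
  | left k =>
    simp only [Fin.append_left]
    induction k using Fin.addCases with
    | left k₀ => simp only [Fin.append_left]
    | right k₁ =>
      exfalso
      have h1 := k₁.isLt
      simp only [Fin.val_castAdd, Fin.val_natAdd] at hi
      omega
  | right k => simp only [Fin.append_right]

/-- Degree bookkeeping: `k^C ≤ c₁·√L` once `c₁·√k ≥ 1` and `L ≥ k^{2C+1}`. -/
private theorem pow_le_mul_sqrt {c₁ : ℝ} (hc₁ : 0 < c₁) {k C L : ℕ} (hck : 1 ≤ c₁ * Real.sqrt k)
    (hL : k ^ (2 * C + 1) ≤ L) : ((k ^ C : ℕ) : ℝ) ≤ c₁ * Real.sqrt L := by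
  have hsqrt : (k : ℝ) ^ C * Real.sqrt k ≤ Real.sqrt L := by
    have h2 : ((k ^ (2 * C + 1) : ℕ) : ℝ) ≤ L := by exact_mod_cast hL
    have h1 : ((k : ℝ) ^ C) ^ 2 * k ≤ L := by
      calc ((k : ℝ) ^ C) ^ 2 * k = (k : ℝ) ^ (2 * C + 1) := by ring
        _ ≤ L := by push_cast at h2; exact h2
    calc (k : ℝ) ^ C * Real.sqrt k = Real.sqrt (((k : ℝ) ^ C) ^ 2 * k) := by
          rw [Real.sqrt_mul (by positivity), Real.sqrt_sq (by positivity)]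
      _ ≤ Real.sqrt L := Real.sqrt_le_sqrt h1
  push_cast
  calc (k : ℝ) ^ C = (k : ℝ) ^ C * 1 := (mul_one _).symm
    _ ≤ (k : ℝ) ^ C * (c₁ * Real.sqrt k) := mul_le_mul_of_nonneg_left hck (by positivity)
    _ = c₁ * ((k : ℝ) ^ C * Real.sqrt k) := by ring
    _ ≤ c₁ * Real.sqrt L := mul_le_mul_of_nonneg_left hsqrt hc₁.le

/-- **THE BLIND-WINDOW THEOREM (polylog form).**  There is `θ < 1` such that for every `C` and
all large `n`: every walk strategy on `n` bits with selectors of degree `≤ (log₂ n)^C` whose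
selectors at the positions strictly inside some window `(p, p + ℓ)` of `ℓ ≥ 2(log₂ n)^{2C+1}`
input bits depend only on the bits OUTSIDE that window wins the ring game in walk coordinates, for
every charge, on at most `θ·2ⁿ` inputs.  So crux α is reduced to strategies that read every
polylog window from inside it. (Cell theorem.) [cite: Srinivasan2023, Lemma 3.1] -/
theorem ringWinU_blindWindow_le :
    ∃ θ : ℝ, θ < 1 ∧ ∀ C : ℕ, ∃ n₀ : ℕ, ∀ n ≥ n₀, ∀ p ℓ : ℕ, p + ℓ ≤ n →
      2 * (Nat.log 2 n) ^ (2 * C + 1) ≤ ℓ → ∀ c : ℕ, ∀ y : Fin (n + 1) → (Fin n → Bool) → Bool,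
        (∀ g, HasDeg (y g) ((Nat.log 2 n) ^ C)) →
        (∀ g : Fin (n + 1), p < g.val → g.val < p + ℓ → ∀ u u' : Fin n → Bool,
          (∀ i : Fin n, i.val < p ∨ p + ℓ ≤ i.val → u i = u' i) → y g u = y g u') →
          ((univ.filter fun u : Fin n → Bool => ringWinU c y u = true).card : ℝ) ≤
            θ * (2 : ℝ) ^ n := by
  obtain ⟨θ, hθ, c₁, hc₁, ℓ₀, H⟩ := ringWinU_blindWindow_sqrt_le
  refine ⟨θ, hθ, fun C => ⟨2 ^ (max (ℓ₀ + 1) (⌈1 / c₁ ^ 2⌉₊ + 1)), ?_⟩⟩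
  intro n hn p ℓ hpl hℓ c y hdeg hblind
  -- split the window into two halves
  obtain ⟨L, M, rfl, hL, hM⟩ : ∃ L M : ℕ, ℓ = L + M ∧ (Nat.log 2 n) ^ (2 * C + 1) ≤ L ∧
      (Nat.log 2 n) ^ (2 * C + 1) ≤ M := ⟨ℓ / 2, ℓ - ℓ / 2, by omega, by omega, by omega⟩
  obtain ⟨q, rfl⟩ : ∃ q, n = p + (L + M) + q := ⟨n - (p + (L + M)), by omega⟩
  set k := Nat.log 2 (p + (L + M) + q) with hk
  have hm : max (ℓ₀ + 1) (⌈1 / c₁ ^ 2⌉₊ + 1) ≤ k := Nat.le_log_of_pow_le one_lt_two hn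
  have hkℓ : ℓ₀ + 1 ≤ k := le_trans (le_max_left _ _) hm
  have hk1 : ⌈1 / c₁ ^ 2⌉₊ + 1 ≤ k := le_trans (le_max_right _ _) hm
  have hkk : k ≤ k ^ (2 * C + 1) := Nat.le_self_pow (by omega) k
  have hℓ₀L : ℓ₀ ≤ L := by omega
  have hℓ₀M : ℓ₀ ≤ M := by omega
  -- `c₁ √k ≥ 1`
  have hck : 1 ≤ c₁ * Real.sqrt k := by
    have h2 : ((⌈1 / c₁ ^ 2⌉₊ : ℕ) : ℝ) + 1 ≤ k := by exact_mod_cast hk1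
    have h3 : (1 / c₁ ^ 2 : ℝ) ≤ ((⌈1 / c₁ ^ 2⌉₊ : ℕ) : ℝ) := Nat.le_ceil _
    have h1 : (1 / c₁ ^ 2 : ℝ) ≤ k := by linarith
    rw [div_le_iff₀ (by positivity)] at h1
    calc (1 : ℝ) = Real.sqrt 1 := Real.sqrt_one.symm
      _ ≤ Real.sqrt (c₁ ^ 2 * k) := Real.sqrt_le_sqrt (by linarith)
      _ = c₁ * Real.sqrt k := by rw [Real.sqrt_mul (by positivity), Real.sqrt_sq hc₁.le]
  have hDL := pow_le_mul_sqrt (C := C) hc₁ hck hL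
  have hDM := pow_le_mul_sqrt (C := C) hc₁ hck hM
  -- blindness in glued form
  have hblind' : ∀ g : Fin (p + (L + M) + q + 1), p < g.val → g.val < p + (L + M) →
      ∀ (a : Fin p → Bool) (v v' : Fin (L + M) → Bool) (b : Fin q → Bool),
        y g (glue3 a v b) = y g (glue3 a v' b) :=
    fun g h1 h2 a v v' b => hblind g h1 h2 _ _ fun i hi => glue3_eq_outside a v v' b i hi
  exact H p L M q hℓ₀L hℓ₀M _ hDL hDM c y hdeg hblind'

end Summit.QuantumAdvantage.AdviceFreeQNC0
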